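import Summits.QuantumFields.YangMills.Theorems.FluctuationComparisonRegPrIntLS1aTowerSfCutDock
import HarnessLib

/-!
# `FluctuationComparisonRegPrIntLS1aTowerFullWindowMinorant` — A CONTINUOUS, STRICTLY POSITIVE MINORANT OF THE CUT TOWER'S DENSITY ON THE FULL WINDOW: the floors
# edition of the tower-law sandwich, and the input of the Γ-averaged-version door (✓p820698 `canonVersion_orbAvg_pos_on`) that turns «(p) for the FINAL version ⟸ (c)»
# into one composition (FILE E of the S1aᴴ (w)(p)(m3) chain ✓p819387 ∕ ✓p819880 ∕ ✓p820495 ∕ ✓p820872 ∕ ✓p821424)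

Cell `ym3-torus` (YM ladder rung R3 = continuum `SU(2)` Yang–Mills on T³ — NOT d = 4, NOT infinite volume, NOT a mass gap, NOT Clay); width seat
`ym3-torus-px21` (gen 22), WIDTH COPY of ★p1 «CMP 102 Thm 1's inputs AS PRINTED vs AS TYPED, every gap named».  Helper of the crux
`stmt-QuantumFields-20520` `FluctuationComparisonRegPrIntL` (`--kind proof --supports … --as helper`, count-neutral).  THEOREMS ONLY: definition-free,
default heartbeats, no `instance`∕`notation`.

WHY (★★OWNER RULING №86 (2)(i)).  ✓p820872∕✓p821424 give S1aᴴ's (p) ∧ (w) for ONE MEASURABLE version; (p) is pointwise and does not transfer to the version that (c)∕(a) will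
force.  px17 g20's ✓p820698 `canonVersion_orbAvg_pos_on` makes the transfer a theorem GIVEN a minorant: `U` open with `U ⊆ regSet dU ρ₀` (= (c)), `f` continuous and `> 0` on
`U`, `f ≤ ρ₀` a.e. on `U` ⟹ the Γ-averaged canonical version is `> 0` on `U`.  THIS FILE supplies `f` on the FULL window `U = {PlaqSmall (θBal F.L γ b₀ p₀ j)}`:
* §1 ★`smul_map_restrict_le_tower` — FLOORS edition of ✓p819387 `map_restrict_le_tower`: if the cut weights met on the way down from run `K` are `≥ ofReal (q i)` on `E`
  (`0 ≤ q i`), then `ofReal (∏_{i ∈ Icc (j+1) Ts} q i) • (D_{j,K})_*(Gibbs_K∣E) ≤ μ j`; ★`density_lower_floor_ae`: hence EVERY density `f` of `μ j` satisfies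
  `ofReal ((∏ q)·Z_K⁻¹·heightDensity F γ hjK E) ≤ f` a.e. (lit ✓`map_descendTo_restrict_eq_withDensity`).
* §2 ★★★`exists_continuous_pos_minorant_fullWindow`: with `E = histGood F ℰp θ″ K j`, `θ″ = (θ_i, i ≤ j; (19∕20)·θ_i above)` and the floor hypothesis
  `PlaqSmall ((19∕20)·θ_i) U → ofReal (q i) ≤ χ i U` (`j < i ≤ Ts`, `0 < q i`): for `0 < γ ≤ γ₁(L, b₀, p₀)` and `jV ≤ j ≤ K`, `∃ g` CONTINUOUS on the window, `> 0` on the window,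
  with `ofReal (g V) ≤ f V` a.e. for every density `f` of `μ j` (`g := (∏ q)·Z_K⁻¹·heightDensityCan … (histGood θ″ K j)`; continuity: ✓p820495 `regSet_and_pos_profile`
  (window ⊆ `regSet`) + lit ✓`Node00.continuousOn_canonVersion`; positivity: ✓p820495 + the interior history of ✓p820872 `exists_lift_profile`).
* §3 ★★★`exists_continuous_pos_minorant_fullWindow_sfCut`: the line's (½, 24∕25) cut term docked with `q i := (1∕46)^{#Plaq_i}` (`floor_ofReal_sfCut2425`: each ramp factor is
  `≥ (24∕25 − 19∕20)∕(24∕25 − 1∕2) = 1∕46` on the `(19∕20)·θ`-window) — NO hypothesis on the cut left.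
NOTHING of Bałaban's is asserted or proved; (c) («window ⊆ regSet dU_j ρ₀», UV3-NODE §67.3) is NOT asserted here — it is the remaining input of the transfer.

HONEST: S1a(ᴴ): (m)-conjunct AS TYPED misstated by currency (★★OWNER RULING №80; repair (R-β1′) requested), AS PRINTED OPEN; (c)∕(a) untouched; `stub_runClassMembershipH` untouched
(RULING №86: versioned conjunct supply, not a discharge); the five registered stubs of `Lines/semiclassical_s2beta.lean` (3732b7df) ∕ crux 20520 ∕ 19936 ∕ 19200 ∕ `YM3TorusSU2`
NOT proved; registry untouched; rung R3 = SU(2) YM₃ on T³ at fixed lattice data — NOT d = 4, NOT infinite volume, NOT a mass gap, NOT Clay; the Yang–Mills mass gap is NOT proved.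
References: [Balaban1985UV3] CMP 102 (1985) (2) p. 256, (7) p. 257, (47) p. 267; [Balaban1987RG1] CMP 109 (1987) (0.13) p. 254, (2.10) p. 267; [Balaban1985Averaging] CMP 98 (1985) (10) p. 19.
-/

set_option autoImplicit false

noncomputable section

namespace Summit.QuantumFields.YangMills.Theorems.FluctuationComparisonRegPrIntLS1aTowerFullWindowMinorant

open MeasureTheory Filter Topology Set Function
open scoped ENNReal NNReal BigOperators
open Literature.MathematicalPhysics.QuantumFieldTheory.Balaban1983to89
open T3ContinuumYM3Torus T3NestedUnitLaws T3UnitLawDensityEML T3UnitScaleTilt T3LevelShift T3TiltDescent T4Continuum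
open Literature.MathematicalPhysics.QuantumFieldTheory.Balaban1983to89.Missing
open Literature.MathematicalPhysics.QuantumFieldTheory.Balaban1983to89.T3DescentFibreTower (descendTo_descendTo descendTo_self)
open Literature.MathematicalPhysics.QuantumFieldTheory.Balaban1983to89.T3Thresholds (exists_gamma_forall_θBal_le)
open scoped Literature.MathematicalPhysics.QuantumFieldTheory.Balaban1983to89.T3OrbitAverage
open Summit.QuantumFields.YangMills.Theorems.FluctuationComparisonRegPrIntLOrganTangentFibredChartDescendTo (descend_eq_descendTo')
open Summit.QuantumFields.YangMills.Theorems.FluctuationComparisonRegPrIntLClassicalPerHeightSteps (histGood_iff_descendTo)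
open Summit.QuantumFields.YangMills.Theorems.FluctuationComparisonRegPrIntLWregGlue (heightDensityCan)
open Summit.QuantumFields.YangMills.Theorems.FluctuationComparisonRegPrIntLWregInterior (isOpen_histGood)
open Summit.QuantumFields.YangMills.Theorems.FluctuationComparisonRegPrIntLS1aTowerLawSandwich
open Summit.QuantumFields.YangMills.Theorems.FluctuationComparisonRegPrIntLS1aTowerDensityVersion (isOpen_window)
open Summit.QuantumFields.YangMills.Theorems.FluctuationComparisonRegPrIntLS1aProfileWindowChart (regSet_and_pos_profile)
open Summit.QuantumFields.YangMills.Theorems.FluctuationComparisonRegPrIntLS1aTowerFullWindow (exists_lift_profile)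
open Summit.QuantumFields.YangMills.Theorems.FluctuationComparisonRegPrIntLS1aTowerSfCutDock

/-! ## §1 The floors edition of the tower-law sandwich -/

section Floors

variable (F : T3Family) {γ : ℝ}
  (χ : (i : ℕ) → GaugeField (F.P i) 0 ↥(Matrix.specialUnitaryGroup (Fin 2) ℂ) → ℝ≥0∞)
  (ν : ℕ → (j : ℕ) → Measure (GaugeField (F.P j) 0 ↥(Matrix.specialUnitaryGroup (Fin 2) ℂ)))
  {K Ts : ℕ}
  (μ : (j : ℕ) → Measure (GaugeField (F.P j) 0 ↥(Matrix.specialUnitaryGroup (Fin 2) ℂ)))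
  (q : ℕ → ℝ)

/-- ★ **THE CUT TOWER LIES ABOVE A SCALED DESCENDED RESTRICTED GIBBS MEASURE — FLOORS EDITION**: for a measurable set `E` of run `K`'s finest fields on which every cut weight met
on the way down is bounded below — `ofReal (q i) ≤ χ i (descendTo F ℰp i K U)` for `U ∈ E`, `j < i ≤ Ts` (`0 ≤ q i`) — one has
`ofReal (∏_{i ∈ Icc (j+1) Ts} q i) • (descendTo F ℰp j K)_*(Gibbs_K∣E) ≤ μ j` (downward induction: `withDensity` is monotone in the density and the measure, a constant density
is a scalar, `map` commutes with scalars; ✓`descend ∘ descendTo = descendTo`). [cite: Balaban1985UV3, (7) p.257 and (47) p.267] -/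
theorem smul_map_restrict_le_tower (hχm : ∀ i, Measurable (χ i)) (hq : ∀ i, 0 ≤ q i)
    (hν1 : ∀ K, ν K K = T4GenFunBounds.gibbsMeasure (F.P K) ((F.scheme ℰp γ).β K))
    (hν2 : ∀ K j, j < K → ν K j = Measure.map (descend F ℰp j) (ν K (j + 1)))
    (hTs : Ts ≤ K)
    (hanch : ∀ j, Ts ≤ j → μ j = ν K j)
    (hcut : ∀ j, j < Ts → μ j = Measure.map (descend F ℰp j) ((μ (j + 1)).withDensity (χ (j + 1))))
    {E : Set (GaugeField (F.P K) 0 ↥(Matrix.specialUnitaryGroup (Fin 2) ℂ))} (hE : MeasurableSet E)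
    {j : ℕ} (hjK : j ≤ K)
    (hEq : ∀ U ∈ E, ∀ (i : ℕ) (_ : j < i) (hiT : i ≤ Ts), ENNReal.ofReal (q i) ≤ χ i (descendTo F ℰp i K (hiT.trans hTs) U)) :
    ENNReal.ofReal (∏ i ∈ Finset.Icc (j + 1) Ts, q i) • Measure.map (descendTo F ℰp j K hjK) ((gibbsK F ℰp γ K).restrict E) ≤ μ j := by
  -- at and above the seed height: empty product, the restricted descended law is below the full one, which IS `μ j`
  have htop : ∀ (j : ℕ) (hjK : j ≤ K), Ts ≤ j →
      ENNReal.ofReal (∏ i ∈ Finset.Icc (j + 1) Ts, q i) • Measure.map (descendTo F ℰp j K hjK) ((gibbsK F ℰp γ K).restrict E) ≤ μ j := by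
    intro j hjK hj
    have hempty : Finset.Icc (j + 1) Ts = ∅ := Finset.Icc_eq_empty_of_lt (by omega)
    rw [hempty, Finset.prod_empty, ENNReal.ofReal_one, one_smul, hanch j hj, run_eq_map_descendTo F ν hν1 hν2 hjK]
    exact Measure.map_mono Measure.restrict_le_self (measurable_descendTo F ℰp measurableE_ℰp hjK)
  suffices h : ∀ (n j : ℕ) (hjK : j ≤ K), j + n = Ts →
      (∀ U ∈ E, ∀ (i : ℕ) (_ : j < i) (hiT : i ≤ Ts), ENNReal.ofReal (q i) ≤ χ i (descendTo F ℰp i K (hiT.trans hTs) U)) →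
      ENNReal.ofReal (∏ i ∈ Finset.Icc (j + 1) Ts, q i) • Measure.map (descendTo F ℰp j K hjK) ((gibbsK F ℰp γ K).restrict E) ≤ μ j by
    rcases le_or_gt Ts j with hj | hj
    · exact htop j hjK hj
    · exact h (Ts - j) j hjK (by omega) hEq
  intro n
  induction n with
  | zero =>
    intro j hjK hj _
    rw [add_zero] at hj
    exact htop j hjK hj.ge
  | succ n ih =>
    intro j hjK hj hEq
    have hjT : j < Ts := by omega
    have hjK' : j + 1 ≤ K := by omega
    have hd : Measurable (descend F ℰp j : GaugeField (F.P (j + 1)) 0 ↥(Matrix.specialUnitaryGroup (Fin 2) ℂ) →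
        GaugeField (F.P j) 0 ↥(Matrix.specialUnitaryGroup (Fin 2) ℂ)) := measurable_descend F ℰp measurableE_ℰp j
    have hD : Measurable (descendTo F ℰp (j + 1) K hjK' : GaugeField (F.P K) 0 ↥(Matrix.specialUnitaryGroup (Fin 2) ℂ) →
        GaugeField (F.P (j + 1)) 0 ↥(Matrix.specialUnitaryGroup (Fin 2) ℂ)) := measurable_descendTo F ℰp measurableE_ℰp hjK'
    -- the induction hypothesis one level up
    have hIH : ENNReal.ofReal (∏ i ∈ Finset.Icc (j + 1 + 1) Ts, q i) • Measure.map (descendTo F ℰp (j + 1) K hjK') ((gibbsK F ℰp γ K).restrict E) ≤ μ (j + 1) :=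
      ih (j + 1) hjK' (by omega) fun U hU i hi hiT => hEq U hU i (by omega) hiT
    -- the floor of `χ (j+1)` on the image of `E`
    have hfloor : ∀ U ∈ E, ENNReal.ofReal (q (j + 1)) ≤ χ (j + 1) (descendTo F ℰp (j + 1) K hjK' U) := fun U hU => hEq U hU (j + 1) (by omega) (by omega)
    -- peel the bottom factor of the product
    have hprod : ∏ i ∈ Finset.Icc (j + 1) Ts, q i = q (j + 1) * ∏ i ∈ Finset.Icc (j + 1 + 1) Ts, q i := by
      rw [← Finset.insert_Icc_add_one_left_eq_Icc (show j + 1 ≤ Ts by omega), Finset.prod_insert (by simp)]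
    -- `descend j ∘ descendTo (j+1) K = descendTo j K`
    have e : (descendTo F ℰp j K hjK : GaugeField (F.P K) 0 ↥(Matrix.specialUnitaryGroup (Fin 2) ℂ) →
        GaugeField (F.P j) 0 ↥(Matrix.specialUnitaryGroup (Fin 2) ℂ)) = descend F ℰp j ∘ descendTo F ℰp (j + 1) K hjK' := by
      funext U
      show descendTo F ℰp j K hjK U = descend F ℰp j (descendTo F ℰp (j + 1) K hjK' U)
      rw [descend_eq_descendTo' F j (Nat.le_succ j), descendTo_descendTo]
    -- the chain one level up
    have h1 : ((gibbsK F ℰp γ K).restrict E).withDensity (fun _ => ENNReal.ofReal (q (j + 1))) ≤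
        ((gibbsK F ℰp γ K).restrict E).withDensity (fun U => χ (j + 1) (descendTo F ℰp (j + 1) K hjK' U)) :=
      withDensity_mono ((ae_restrict_iff' hE).mpr (ae_of_all _ fun U hU => hfloor U hU))
    have hchain : (ENNReal.ofReal (q (j + 1)) * ENNReal.ofReal (∏ i ∈ Finset.Icc (j + 1 + 1) Ts, q i)) •
        Measure.map (descendTo F ℰp (j + 1) K hjK') ((gibbsK F ℰp γ K).restrict E) ≤ (μ (j + 1)).withDensity (χ (j + 1)) :=
      calc (ENNReal.ofReal (q (j + 1)) * ENNReal.ofReal (∏ i ∈ Finset.Icc (j + 1 + 1) Ts, q i)) •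
            Measure.map (descendTo F ℰp (j + 1) K hjK') ((gibbsK F ℰp γ K).restrict E)
          = ENNReal.ofReal (∏ i ∈ Finset.Icc (j + 1 + 1) Ts, q i) •
              (ENNReal.ofReal (q (j + 1)) • Measure.map (descendTo F ℰp (j + 1) K hjK') ((gibbsK F ℰp γ K).restrict E)) := by
            rw [smul_smul, mul_comm]
        _ = ENNReal.ofReal (∏ i ∈ Finset.Icc (j + 1 + 1) Ts, q i) •
              Measure.map (descendTo F ℰp (j + 1) K hjK') (((gibbsK F ℰp γ K).restrict E).withDensity (fun _ => ENNReal.ofReal (q (j + 1)))) := by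
            rw [withDensity_const, Measure.map_smul]
        _ ≤ ENNReal.ofReal (∏ i ∈ Finset.Icc (j + 1 + 1) Ts, q i) •
              Measure.map (descendTo F ℰp (j + 1) K hjK') (((gibbsK F ℰp γ K).restrict E).withDensity (fun U => χ (j + 1) (descendTo F ℰp (j + 1) K hjK' U))) :=
            Measure.le_iff.mpr fun s hs => by
              simp only [Measure.smul_apply, smul_eq_mul]
              exact mul_le_mul' le_rfl (Measure.le_iff.mp (Measure.map_mono h1 hD) s hs)
        _ = ENNReal.ofReal (∏ i ∈ Finset.Icc (j + 1 + 1) Ts, q i) •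
              (Measure.map (descendTo F ℰp (j + 1) K hjK') ((gibbsK F ℰp γ K).restrict E)).withDensity (χ (j + 1)) := by
            rw [map_withDensity_comp_eq hD (hχm (j + 1))]
        _ = (ENNReal.ofReal (∏ i ∈ Finset.Icc (j + 1 + 1) Ts, q i) •
              Measure.map (descendTo F ℰp (j + 1) K hjK') ((gibbsK F ℰp γ K).restrict E)).withDensity (χ (j + 1)) := by
            rw [withDensity_smul_measure]
        _ ≤ (μ (j + 1)).withDensity (χ (j + 1)) := withDensity_mono_measure hIH _
    rw [hcut j hjT, e, ← Measure.map_map hd hD, hprod, ENNReal.ofReal_mul (hq _), ← Measure.map_smul]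
    exact Measure.map_mono hchain hd

/-- ★ **EVERY DENSITY OF THE CUT TOWER INHERITS THE FLOORED LOWER EDGE A.E.**: under the floor hypothesis of `smul_map_restrict_le_tower`, every measurable density `f` of `μ j`
satisfies `ofReal ((∏_{i ∈ Icc (j+1) Ts} q i)·Z_K⁻¹·heightDensity F γ hjK E) ≤ f` `dU_j`-a.e. (no measurability of `f` needed) (lit ✓`map_descendTo_restrict_eq_withDensity`, `withDensity_smul`).
[cite: Balaban1985UV3, (2) p.256 and (47) p.267] -/
theorem density_lower_floor_ae (hγ : 0 ≤ γ) (hχm : ∀ i, Measurable (χ i)) (hq : ∀ i, 0 ≤ q i)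
    (hν1 : ∀ K, ν K K = T4GenFunBounds.gibbsMeasure (F.P K) ((F.scheme ℰp γ).β K))
    (hν2 : ∀ K j, j < K → ν K j = Measure.map (descend F ℰp j) (ν K (j + 1)))
    (hTs : Ts ≤ K)
    (hanch : ∀ j, Ts ≤ j → μ j = ν K j)
    (hcut : ∀ j, j < Ts → μ j = Measure.map (descend F ℰp j) ((μ (j + 1)).withDensity (χ (j + 1))))
    {E : Set (GaugeField (F.P K) 0 ↥(Matrix.specialUnitaryGroup (Fin 2) ℂ))} (hE : MeasurableSet E)
    {j : ℕ} (hjK : j ≤ K)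
    (hEq : ∀ U ∈ E, ∀ (i : ℕ) (_ : j < i) (hiT : i ≤ Ts), ENNReal.ofReal (q i) ≤ χ i (descendTo F ℰp i K (hiT.trans hTs) U))
    {f : GaugeField (F.P j) 0 ↥(Matrix.specialUnitaryGroup (Fin 2) ℂ) → ℝ≥0∞}
    (hμf : μ j = (fieldMeasure (F.P j) 0 ↥(Matrix.specialUnitaryGroup (Fin 2) ℂ)).withDensity f) :
    (fun V => ENNReal.ofReal ((∏ i ∈ Finset.Icc (j + 1) Ts, q i) *
        ((partitionFn (G := ↥(Matrix.specialUnitaryGroup (Fin 2) ℂ)) (F.P K) ((F.scheme ℰp γ).β K))⁻¹ * heightDensity F γ hjK E V)))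
      ≤ᵐ[fieldMeasure (F.P j) 0 ↥(Matrix.specialUnitaryGroup (Fin 2) ℂ)] f := by
  have hle := smul_map_restrict_le_tower F χ ν μ q hχm hq hν1 hν2 hTs hanch hcut hE hjK hEq
  rw [map_descendTo_restrict_eq_withDensity F hjK hE hγ, hμf] at hle
  have hm : Measurable fun V => ENNReal.ofReal
      ((partitionFn (G := ↥(Matrix.specialUnitaryGroup (Fin 2) ℂ)) (F.P K) ((F.scheme ℰp γ).β K))⁻¹ * heightDensity F γ hjK E V) :=
    ((heightDensity_props F hjK hE hγ).1.const_mul _).ennreal_ofReal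
  rw [← withDensity_smul _ hm] at hle
  have hae := ae_le_of_withDensity_le (hm.const_smul _) hle
  filter_upwards [hae] with V hV
  have hq0 : 0 ≤ ∏ i ∈ Finset.Icc (j + 1) Ts, q i := Finset.prod_nonneg fun i _ => hq i
  calc ENNReal.ofReal ((∏ i ∈ Finset.Icc (j + 1) Ts, q i) *
        ((partitionFn (G := ↥(Matrix.specialUnitaryGroup (Fin 2) ℂ)) (F.P K) ((F.scheme ℰp γ).β K))⁻¹ * heightDensity F γ hjK E V))
      = ENNReal.ofReal (∏ i ∈ Finset.Icc (j + 1) Ts, q i) * ENNReal.ofReal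
          ((partitionFn (G := ↥(Matrix.specialUnitaryGroup (Fin 2) ℂ)) (F.P K) ((F.scheme ℰp γ).β K))⁻¹ * heightDensity F γ hjK E V) := ENNReal.ofReal_mul hq0
    _ ≤ f V := hV

end Floors

/-! ## §2 A continuous, strictly positive minorant on the FULL window -/

/-- ★★★ **A CONTINUOUS STRICTLY POSITIVE MINORANT OF THE CUT TOWER'S DENSITY ON THE FULL WINDOW**: for every `L`, `0 < b₀`, `0 < p₀` there is `γ₁ > 0` such that for every family of block
size `L` and `0 < γ ≤ γ₁` there is a height `jV` with: for every measurable cut `χ` bounded BELOW by `ofReal (q i)` (`0 < q i`) on the `(19∕20)·θ_i`-windows of the heights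
`(j, Ts]`, every run system `ν` and cut tower `μ` of S1aᴴ's shape and every `jV ≤ j ≤ K`, there is `g : GaugeField (F.P j) 0 SU(2) → ℝ`, CONTINUOUS on the `θBal F.L γ b₀ p₀ j`-window,
STRICTLY POSITIVE there, with `ofReal (g V) ≤ f V` a.e. for EVERY density `f` of `μ j` (`μ j = dU_j.withDensity f`, no measurability asked) — the `f`∕`hfpos`∕`hle` inputs of ✓p820698 `canonVersion_orbAvg_pos_on` on
`U` = the full window; its remaining input `U ⊆ regSet dU_j ρ₀` is (c).  (`g := (∏ q)·Z_K⁻¹·heightDensityCan … (histGood F ℰp θ″ K j)`, `θ″ = (θ_i, i ≤ j; (19∕20)·θ_i above)`.)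
[cite: Balaban1985UV3, (2) p.256, (7) p.257 and (47) p.267; Balaban1987RG1, (0.13) p.254 and (2.10) p.267] -/
theorem exists_continuous_pos_minorant_fullWindow (L : ℕ) {b₀ p₀ : ℝ} (hb : 0 < b₀) (hp : 0 < p₀) :
    ∃ γ₁ : ℝ, 0 < γ₁ ∧ ∀ (F : T3Family) (γ : ℝ), F.L = L → 0 < γ → γ ≤ γ₁ → ∃ jV : ℕ,
      ∀ (χ : (i : ℕ) → GaugeField (F.P i) 0 ↥(Matrix.specialUnitaryGroup (Fin 2) ℂ) → ℝ≥0∞), (∀ i, Measurable (χ i)) →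
      ∀ (q : ℕ → ℝ), (∀ i, 0 < q i) →
      ∀ (ν : ℕ → (j : ℕ) → Measure (GaugeField (F.P j) 0 ↥(Matrix.specialUnitaryGroup (Fin 2) ℂ))),
        (∀ K, ν K K = T4GenFunBounds.gibbsMeasure (F.P K) ((F.scheme ℰp γ).β K)) →
        (∀ K j, j < K → ν K j = Measure.map (descend F ℰp j) (ν K (j + 1))) →
      ∀ (K Ts : ℕ) (hTs : Ts ≤ K) (μ : (j : ℕ) → Measure (GaugeField (F.P j) 0 ↥(Matrix.specialUnitaryGroup (Fin 2) ℂ))),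
        (∀ j, Ts ≤ j → μ j = ν K j) →
        (∀ j, j < Ts → μ j = Measure.map (descend F ℰp j) ((μ (j + 1)).withDensity (χ (j + 1)))) →
      ∀ (j : ℕ) (_ : jV ≤ j) (hjK : j ≤ K),
        (∀ (i : ℕ), j < i → i ≤ Ts → ∀ U, PlaqSmall (19 / 20 * θBal F.L γ b₀ p₀ i) U → ENNReal.ofReal (q i) ≤ χ i U) →
        ∃ g : GaugeField (F.P j) 0 ↥(Matrix.specialUnitaryGroup (Fin 2) ℂ) → ℝ,
          ContinuousOn g {V | PlaqSmall (θBal F.L γ b₀ p₀ j) V} ∧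
          (∀ V, PlaqSmall (θBal F.L γ b₀ p₀ j) V → 0 < g V) ∧
          ∀ (f : GaugeField (F.P j) 0 ↥(Matrix.specialUnitaryGroup (Fin 2) ℂ) → ℝ≥0∞),
            μ j = (fieldMeasure (F.P j) 0 ↥(Matrix.specialUnitaryGroup (Fin 2) ℂ)).withDensity f →
              ∀ᵐ V ∂fieldMeasure (F.P j) 0 ↥(Matrix.specialUnitaryGroup (Fin 2) ℂ), ENNReal.ofReal (g V) ≤ f V := by
  -- the lift floor `0.9482… < 19∕20`
  have hc : (3874825 / 7077888 : ℝ) * Real.sqrt ((3 : ℕ) : ℝ) < 19 / 20 := by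
    have hs : Real.sqrt ((3 : ℕ) : ℝ) < 19 / 20 * (7077888 / 3874825) := by
      rw [Real.sqrt_lt' (by norm_num)]
      norm_num
    have h2 := mul_lt_mul_of_pos_left hs (by norm_num : (0 : ℝ) < 3874825 / 7077888)
    have h3 : (3874825 / 7077888 : ℝ) * (19 / 20 * (7077888 / 3874825)) = 19 / 20 := by norm_num
    linarith [h2, h3]
  obtain ⟨γP, hγP, hP⟩ := regSet_and_pos_profile L b₀ p₀ hb hp
  set δ₁ : ℝ := ExpMeanLog.deltaSU (Fin 2) / 2 / ((((3 + 2) * L : ℕ) : ℝ) ^ 2 / 4 + 1) with hδ₁def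
  have hD : 0 < ((((3 + 2) * L : ℕ) : ℝ) ^ 2 / 4 + 1) := by positivity
  have hδ₁ : 0 < δ₁ := by rw [hδ₁def]; exact div_pos (half_pos ExpMeanLog.deltaSU_pos) hD
  obtain ⟨γO, hγO, hγO1, hθO⟩ := exists_gamma_forall_θBal_le (b₀ := b₀) (p₀ := p₀) hb hp hδ₁
  refine ⟨min γP γO, lt_min hγP hγO, fun F γ hFL hγ hγle => ?_⟩
  have hγP' : γ ≤ γP := hγle.trans (min_le_left _ _)
  have hγO' : γ ≤ γO := hγle.trans (min_le_right _ _)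
  have hγ1 : γ ≤ 1 := hγO'.trans hγO1
  have hLF : 1 ≤ F.L := F.hL.2.le
  have hθpos : ∀ i, 0 < θBal F.L γ b₀ p₀ i := fun i => T3MinimiserStabilityReduction.θBal_pos hLF hγ hγ1 hb p₀ i
  have hθδ : ∀ i, θBal F.L γ b₀ p₀ i ≤ δ₁ := fun i => by subst hFL; exact hθO F.L hLF γ hγ hγO' i
  obtain ⟨jV, hlift⟩ := exists_lift_profile hc (by norm_num) F hγ hγ1 hb hp.le
  refine ⟨jV, fun χ hχm q hq ν hν1 hν2 K Ts hTs μ hanch hcut j hjV hjK hfloor => ?_⟩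
  haveI : BorelSpace (GaugeField (F.P j) 0 ↥(Matrix.specialUnitaryGroup (Fin 2) ℂ)) := T3OrbitAverage.instBorelSpaceGaugeField
  haveI : SecondCountableTopology (GaugeField (F.P j) 0 ↥(Matrix.specialUnitaryGroup (Fin 2) ℂ)) := T3OrbitAverage.instSecondCountableGaugeField
  haveI : (fieldMeasure (F.P j) 0 ↥(Matrix.specialUnitaryGroup (Fin 2) ℂ)).IsOpenPosMeasure :=
    B12ContinuousTransportInvariance.isOpenPosMeasure_fieldMeasure_SU (N := 2) (F.P j) 0
  set θ : ℕ → ℝ := θBal F.L γ b₀ p₀ with hθdef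
  set c : ℝ := 19 / 20 with hcdef
  set θ'' : ℕ → ℝ := fun i => if i ≤ j then θ i else c * θ i with hθ''def
  have hθ''j : θ'' j = θ j := by simp [hθ''def]
  have hθ''gt : ∀ i, j < i → θ'' i = c * θ i := fun i hi => by simp [hθ''def, not_le.mpr hi]
  have hθ''0 : ∀ i, 0 < θ'' i := by
    intro i
    by_cases hi : i ≤ j
    · rw [show θ'' i = θ i by simp [hθ''def, hi]]; exact hθpos i
    · rw [hθ''gt i (not_le.mp hi)]; exact mul_pos (by norm_num) (hθpos i)
  have hθ''le : ∀ i, θ'' i ≤ θ i := by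
    intro i
    by_cases hi : i ≤ j
    · rw [show θ'' i = θ i by simp [hθ''def, hi]]
    · rw [hθ''gt i (not_le.mp hi), hcdef]; nlinarith [hθpos i]
  -- openness of `E″ = histGood θ″ K j` and the interior history of every window point
  have hsmall : (((((F.P K).d + 2) * (F.P K).L : ℕ) : ℝ) ^ 2 / 4) * δ₁ ≤ ExpMeanLog.deltaSU (Fin 2) / 2 := by
    have hd : (F.P K).d = 3 := T3Family.P_d F K
    have hLL : (F.P K).L = F.L := rfl
    rw [hd, hLL, hFL, hδ₁def, mul_div_assoc', div_le_iff₀ hD]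
    have hq' : 0 ≤ ExpMeanLog.deltaSU (Fin 2) / 2 := (half_pos ExpMeanLog.deltaSU_pos).le
    nlinarith [hq']
  set E'' : Set (GaugeField (F.P K) 0 ↥(Matrix.specialUnitaryGroup (Fin 2) ℂ)) := histGood F ℰp θ'' K j with hE''def
  have hopen : IsOpen E'' := isOpen_histGood F hδ₁.le (fun i => (hθ''le i).trans (hθδ i)) hsmall hjK
  have hE''m : MeasurableSet E'' := measurableSet_histGood F ℰp measurableE_ℰp _ K j
  have hint : ∀ V : GaugeField (F.P j) 0 ↥(Matrix.specialUnitaryGroup (Fin 2) ℂ), PlaqSmall (θ j) V →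
      ∃ U, descendTo F ℰp j K hjK U = V ∧ U ∈ interior E'' := by
    intro V hV
    obtain ⟨U, hUV, -, hUn⟩ := hlift j hjV K hjK V hV
    refine ⟨U, hUV, ?_⟩
    rw [hopen.interior_eq, hE''def, histGood_iff_descendTo]
    intro n hjn hnK
    rcases hjn.lt_or_eq with hlt | heq
    · rw [hθ''gt n hlt]; exact hUn n hlt hnK
    · subst heq
      rw [hθ''j, hUV]; exact hV
  -- C2 at the profile `θ″`: window ⊆ regSet of the restricted density, canonical version positive on the window
  obtain ⟨hreg, hPos⟩ := hP F γ hFL hγ hγP' θ'' hθ''0 hθ''le j K hjK γ hγ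
  have hreg' : {V : GaugeField (F.P j) 0 ↥(Matrix.specialUnitaryGroup (Fin 2) ℂ) | PlaqSmall (θ j) V} ⊆
      Node00.regSet (fieldMeasure (F.P j) 0 ↥(Matrix.specialUnitaryGroup (Fin 2) ℂ)) (heightDensity F γ hjK E'') := by
    intro V hV; exact hreg (by rw [hθ''j]; exact hV)
  -- the constants
  set Z : ℝ := partitionFn (G := ↥(Matrix.specialUnitaryGroup (Fin 2) ℂ)) (F.P K) ((F.scheme ℰp γ).β K) with hZdef
  have hZ : 0 < Z := partitionFn_pos' _ (F.scheme_β_nonneg ℰp hγ.le K)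
  set cq : ℝ := ∏ i ∈ Finset.Icc (j + 1) Ts, q i with hcqdef
  have hcq : 0 < cq := Finset.prod_pos fun i _ => hq i
  -- the minorant
  refine ⟨fun V => cq * (Z⁻¹ * heightDensityCan F γ hjK E'' V), ?_, ?_, ?_⟩
  · exact continuousOn_const.mul (continuousOn_const.mul (Node00.continuousOn_canonVersion.mono hreg'))
  · intro V hV
    exact mul_pos hcq (mul_pos (inv_pos.mpr hZ) (hPos V (by rw [hθ''j]; exact hV) (hint V hV)))
  · intro f hμf
    have hEq : ∀ U ∈ E'', ∀ (i : ℕ) (_ : j < i) (hiT : i ≤ Ts), ENNReal.ofReal (q i) ≤ χ i (descendTo F ℰp i K (hiT.trans hTs) U) := by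
      intro U hU i hji hiT
      have h := (histGood_iff_descendTo F).mp hU i hji.le (hiT.trans hTs)
      rw [hθ''gt i hji] at h
      exact hfloor i hji hiT _ h
    have hlow := density_lower_floor_ae F χ ν μ q hγ.le hχm (fun i => (hq i).le) hν1 hν2 hTs hanch hcut hE''m hjK hEq hμf
    have hcan : heightDensityCan F γ hjK E'' =ᵐ[fieldMeasure (F.P j) 0 ↥(Matrix.specialUnitaryGroup (Fin 2) ℂ)] heightDensity F γ hjK E'' :=
      Node00.canonVersion_ae_eq
    filter_upwards [hlow, hcan] with V h1 h2
    rw [h2]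
    exact h1

/-! ## §3 Docking the line's own cut -/

/-- **FLOOR OF THE (½, 24∕25) CUT TERM ON THE `(19∕20)·θ`-WINDOW**: every ramp factor is `≥ (24∕25 − 19∕20)∕(24∕25 − 1∕2) = 1∕46` there (`θ > 0`), so the term is
`≥ (1∕46)^{#Plaq}`. [cite: Balaban1985UV3, (7) p.257] -/
theorem floor_ofReal_sfCut2425 {P : Params} {k : ℕ} {θ : ℝ} (hθ : 0 < θ) (U : GaugeField P k ↥(Matrix.specialUnitaryGroup (Fin 2) ℂ))
    (hU : PlaqSmall (19 / 20 * θ) U) :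
    ENNReal.ofReal ((1 / 46 : ℝ) ^ Fintype.card (Plaq P k)) ≤
      ENNReal.ofReal (∏ p : Plaq P k, max 0 (min 1 ((24 / 25 * θ - dist1 (GaugeField.plaqHol U p)) / ((24 / 25 - 1 / 2) * θ)))) := by
  refine ENNReal.ofReal_le_ofReal ?_
  rw [← Finset.card_univ, ← Finset.prod_const]
  refine Finset.prod_le_prod (fun _ _ => by norm_num) fun p _ => ?_
  have hp : dist1 (GaugeField.plaqHol U p) < 19 / 20 * θ := hU p
  have h1 : (1 / 46 : ℝ) ≤ (24 / 25 * θ - dist1 (GaugeField.plaqHol U p)) / ((24 / 25 - 1 / 2) * θ) := by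
    rw [le_div_iff₀ (by nlinarith)]; nlinarith
  exact le_max_of_le_right (le_min (by norm_num) h1)

/-- ★★★ **THE MINORANT FOR THE LINE'S OWN CUT, NO HYPOTHESIS ON THE CUT LEFT**: for the `sfCut (θBal F.L γ b₀ p₀ ·)`-cut tower of S1aᴴ (the (½, 24∕25) term), for `0 < γ ≤ γ₁(L, b₀, p₀)`
and every `jV ≤ j ≤ K`: `∃ g` continuous and strictly positive on the `θBal F.L γ b₀ p₀ j`-window with `ofReal (g V) ≤ f V` a.e. for every density `f` of `μ j`
(§2 at `q i := (1∕46)^{#Plaq_i}`). [cite: Balaban1985UV3, (2) p.256, (7) p.257 and (47) p.267] -/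
theorem exists_continuous_pos_minorant_fullWindow_sfCut (L : ℕ) {b₀ p₀ : ℝ} (hb : 0 < b₀) (hp : 0 < p₀) :
    ∃ γ₁ : ℝ, 0 < γ₁ ∧ ∀ (F : T3Family) (γ : ℝ), F.L = L → 0 < γ → γ ≤ γ₁ → ∃ jV : ℕ,
      ∀ (ν : ℕ → (j : ℕ) → Measure (GaugeField (F.P j) 0 ↥(Matrix.specialUnitaryGroup (Fin 2) ℂ))),
        (∀ K, ν K K = T4GenFunBounds.gibbsMeasure (F.P K) ((F.scheme ℰp γ).β K)) →
        (∀ K j, j < K → ν K j = Measure.map (descend F ℰp j) (ν K (j + 1))) →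
      ∀ (K Ts : ℕ) (_ : Ts ≤ K) (μ : (j : ℕ) → Measure (GaugeField (F.P j) 0 ↥(Matrix.specialUnitaryGroup (Fin 2) ℂ))),
        (∀ j, Ts ≤ j → μ j = ν K j) →
        (∀ j, j < Ts → μ j = Measure.map (descend F ℰp j) ((μ (j + 1)).withDensity (fun U => ENNReal.ofReal
          (∏ p : Plaq (F.P (j + 1)) 0, max 0 (min 1 ((24 / 25 * θBal F.L γ b₀ p₀ (j + 1) - dist1 (GaugeField.plaqHol U p)) /
            ((24 / 25 - 1 / 2) * θBal F.L γ b₀ p₀ (j + 1)))))))) →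
      ∀ (j : ℕ) (_ : jV ≤ j) (hjK : j ≤ K),
        ∃ g : GaugeField (F.P j) 0 ↥(Matrix.specialUnitaryGroup (Fin 2) ℂ) → ℝ,
          ContinuousOn g {V | PlaqSmall (θBal F.L γ b₀ p₀ j) V} ∧
          (∀ V, PlaqSmall (θBal F.L γ b₀ p₀ j) V → 0 < g V) ∧
          ∀ (f : GaugeField (F.P j) 0 ↥(Matrix.specialUnitaryGroup (Fin 2) ℂ) → ℝ≥0∞),
            μ j = (fieldMeasure (F.P j) 0 ↥(Matrix.specialUnitaryGroup (Fin 2) ℂ)).withDensity f →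
              ∀ᵐ V ∂fieldMeasure (F.P j) 0 ↥(Matrix.specialUnitaryGroup (Fin 2) ℂ), ENNReal.ofReal (g V) ≤ f V := by
  obtain ⟨γ₁, hγ₁, H⟩ := exists_continuous_pos_minorant_fullWindow L hb hp
  refine ⟨min γ₁ 1, lt_min hγ₁ one_pos, fun F γ hFL hγ hγle => ?_⟩
  have hγ₁' : γ ≤ γ₁ := hγle.trans (min_le_left _ _)
  have hγ1 : γ ≤ 1 := hγle.trans (min_le_right _ _)
  have hLF : 1 ≤ F.L := F.hL.2.le
  obtain ⟨jV, HV⟩ := H F γ hFL hγ hγ₁'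
  set χ : (i : ℕ) → GaugeField (F.P i) 0 ↥(Matrix.specialUnitaryGroup (Fin 2) ℂ) → ℝ≥0∞ := fun i U => ENNReal.ofReal
    (∏ p : Plaq (F.P i) 0, max 0 (min 1 ((24 / 25 * θBal F.L γ b₀ p₀ i - dist1 (GaugeField.plaqHol U p)) /
      ((24 / 25 - 1 / 2) * θBal F.L γ b₀ p₀ i)))) with hχdef
  have hχm : ∀ i, Measurable (χ i) := fun i => measurable_ofReal_sfCut2425 _
  have hθpos : ∀ i, 0 < θBal F.L γ b₀ p₀ i := fun i => T3MinimiserStabilityReduction.θBal_pos hLF hγ hγ1 hb p₀ i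
  set q : ℕ → ℝ := fun i => (1 / 46 : ℝ) ^ Fintype.card (Plaq (F.P i) 0) with hqdef
  have hq : ∀ i, 0 < q i := fun i => by rw [hqdef]; positivity
  refine ⟨jV, fun ν hν1 hν2 K Ts hTs μ hanch hcut j hjV hjK => ?_⟩
  have hcut' : ∀ j, j < Ts → μ j = Measure.map (descend F ℰp j) ((μ (j + 1)).withDensity (χ (j + 1))) := hcut
  exact HV χ hχm q hq ν hν1 hν2 K Ts hTs μ hanch hcut' j hjV hjK (fun i _ _ U hU => floor_ofReal_sfCut2425 (hθpos i) U hU)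

end Summit.QuantumFields.YangMills.Theorems.FluctuationComparisonRegPrIntLS1aTowerFullWindowMinorant

end
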